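import Summits.ValiantsHypothesis.ValiantsHypothesis.Theorems.SymmetroidDescartesRolleToDescartes

/-!
# `DerivedPencilRolleQuasi` — the spacelike `2 × 2` family (many roots at size `2`, Rolle term dead)

Crux `stmt-ValiantsHypothesis-18064` (`Theses.SymmetroidDescartes.DerivedPencilRolleQuasi`, route
SymmetroidDescartes, the repaired inductive step on the number of terms):
`∃ C A, ∀ m K S d (symmetric, invertible, d strictly increasing),
  Z₊(det F) ≤ C · Z₊(det ∂F) + (K+1)^(A·K) · 2^((log₂ m + 2)^A)`.

Refuter (cdisprove) finding, 2026-08-17.  A SMALL MODEL in which the Rolle term is honestly dead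
while the root count grows with the number of terms at FIXED size `m = 2`:

* the **spacelike `2 × 2` family** `F_D(t) = [[1/2 + p_D(t), Y_D(t)], [Y_D(t), 1/2 − p_D(t)]]`,
  `p_D = 2^D · ∏_{k<D} (X − (k+1))` (vanishes at `1, …, D`, `|p_D| ≥ 1` at the half-integers),
  `Y_D = δ_D · (1 + X + ⋯ + X^D)` a tiny increasing drift (`δ_D = 1/(4 (D+1)^(D+1))`); as a pencil:
  `K = D`, exponents `d l = l`, coefficients `S l = [[c_l + a_l, δ_D], [δ_D, c_l − a_l]]`
  (`a_l` = coefficient of `p_D`, `c_0 = 1/2`, `c_l = 0` else) — symmetric and INVERTIBLE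
  (`det S l = c_l² − a_l² − δ_D² < 0`);
* `det F_D = 1/4 − p_D² − Y_D²` is `> 0` at `t = 1, …, D` and `< 0` at `t = 1/2, 3/2, …, D + 1/2`:
  `2D` sign alternations, hence `Z₊(det F_D) ≥ 2D` (`twoMul_le_card_posRoots_spF`);
* the derived pencil evaluates to `[[u, v], [v, −u]]` with `v = δ_D Σ_{l<D} (l+1) t^l > 0`, so
  `det ∂F_D(t) = −u² − v² < 0` on `(0, ∞)`: `Z₊(det ∂F_D) = 0` (`card_posRoots_derived_spF`) — not as the
  zero polynomial (the triangular-class mechanism of `DerivedPencilRolle/Negative/…TriangularClass…`) but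
  as an everywhere-indefinite velocity: in `Sym₂(ℝ) ≅ ℝ^{1,2}` (`det` = the Lorentz form) the curve
  `t ↦ F_D(t)` is spacelike and crosses the light cone `det = 0` `2D` times.

This file: the construction and its two properties, stated literally in the crux's currency
(`card_posRoots_derived_spF`, `twoMul_le_card_posRoots_spF`).  The consequences for the crux (the term
factor `(K+1)^(A·K)` is load-bearing; no size-only budget; `B(2,K) ≥ 2K`) are in the companion file
`DerivedPencilRolleQuasiTermFactor.lean`.  Nothing here asserts a route statement positively
(Negative/ lane).  Tools (`le_card_posRoots_of_alternating`: alternations ⇒ roots by the IVT;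
`eval_det_pencil`: `det` commutes with evaluation) are the tree's
(`Theorems/SymmetroidDescartesRolleToDescartes.lean`); the family is this seat's. [folklore]
-/

-- `Summit.ValiantsHypothesis.ValiantsHypothesis.…` repeats a component by the D-0017 layout.
set_option linter.dupNamespace false

namespace Summit.ValiantsHypothesis.ValiantsHypothesis.Theorems.DerivedPencilRolleQuasi.Negative

open scoped BigOperators Matrix Polynomial
open Polynomial
open Summit.ValiantsHypothesis.ValiantsHypothesis.Theorems.SymmetroidDescartes
  (eval_det_pencil le_card_posRoots_of_alternating)

/-! ## The spacelike `2 × 2` family -/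

section Family

variable (D : ℕ)

/-- The node polynomial `p_D = 2^D · ∏_{k<D} (X − (k+1))`. -/
noncomputable def nodePoly : ℝ[X] :=
  Polynomial.C ((2 : ℝ) ^ D) * ∏ k ∈ Finset.range D, (X - Polynomial.C ((k : ℝ) + 1))

/-- The drift rate `δ_D = 1 / (4 (D+1)^(D+1))`. -/
noncomputable def driftδ : ℝ := 1 / (4 * ((D : ℝ) + 1) ^ (D + 1))

/-- The coefficient matrices `S l = [[c_l + a_l, δ], [δ, c_l − a_l]]`. -/
noncomputable def spS (l : Fin (D + 1)) : Matrix (Fin 2) (Fin 2) ℝ :=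
  !![(if l = 0 then (1 / 2 : ℝ) else 0) + (nodePoly D).coeff l, driftδ D;
     driftδ D, (if l = 0 then (1 / 2 : ℝ) else 0) - (nodePoly D).coeff l]

/-- The exponents `d l = l` (dense: lacunarity plays no role at fixed size). -/
def spD (l : Fin (D + 1)) : ℕ := l

/-- The exponents `0 < 1 < ⋯ < D` are strictly increasing. -/
theorem spD_strictMono : StrictMono (spD D) := fun _ _ h => h

/-- Every coefficient `S l` is symmetric. -/
theorem spS_isSymm (l : Fin (D + 1)) : (spS D l).IsSymm := by
  unfold Matrix.IsSymm spS
  ext i j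
  fin_cases i <;> fin_cases j <;> rfl

/-- The drift rate is positive. -/
theorem driftδ_pos : 0 < driftδ D := by
  unfold driftδ
  positivity

/-! ### The node polynomial -/

/-- `deg p_D ≤ D`. -/
theorem natDegree_nodePoly_lt : (nodePoly D).natDegree < D + 1 := by
  unfold nodePoly
  have h1 : (∏ k ∈ Finset.range D, (X - Polynomial.C ((k : ℝ) + 1))).natDegree ≤ D := by
    refine (natDegree_prod_le (Finset.range D)
      (fun k : ℕ => (X - Polynomial.C ((k : ℝ) + 1) : ℝ[X]))).trans ?_
    calc ∑ k ∈ Finset.range D, (X - Polynomial.C ((k : ℝ) + 1) : ℝ[X]).natDegree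
        ≤ ∑ k ∈ Finset.range D, (1 : ℕ) :=
          Finset.sum_le_sum fun k _ => natDegree_X_sub_C_le ((k : ℝ) + 1)
      _ = D := by simp
  have h2 := natDegree_C_mul_le ((2 : ℝ) ^ D)
    (∏ k ∈ Finset.range D, (X - Polynomial.C ((k : ℝ) + 1) : ℝ[X]))
  omega

/-- `p_D(t) = 2^D ∏_{k<D} (t − (k+1))`. -/
theorem eval_nodePoly (t : ℝ) :
    (nodePoly D).eval t = 2 ^ D * ∏ k ∈ Finset.range D, (t - ((k : ℝ) + 1)) := by
  simp [nodePoly, eval_prod]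

/-- `p_D` vanishes at the nodes `1, …, D`. -/
theorem eval_nodePoly_nat (i : ℕ) (h1 : 1 ≤ i) (hi : i ≤ D) : (nodePoly D).eval (i : ℝ) = 0 := by
  rw [eval_nodePoly]
  refine mul_eq_zero_of_right _ (Finset.prod_eq_zero (i := i - 1) (Finset.mem_range.2 (by omega)) ?_)
  rw [Nat.cast_sub h1]
  push_cast
  ring

/-- Off the nodes by at least `1/2` in every factor, `|p_D| ≥ 1`. -/
theorem one_le_abs_eval_nodePoly (t : ℝ) (h : ∀ k : ℕ, k < D → 1 / 2 ≤ |t - ((k : ℝ) + 1)|) :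
    1 ≤ |(nodePoly D).eval t| := by
  rw [eval_nodePoly, abs_mul, Finset.abs_prod, abs_of_pos (by positivity : (0 : ℝ) < 2 ^ D)]
  have hprod : ∏ _k ∈ Finset.range D, (1 / 2 : ℝ) ≤ ∏ k ∈ Finset.range D, |t - ((k : ℝ) + 1)| :=
    Finset.prod_le_prod (fun _ _ => by norm_num) fun k hk => h k (Finset.mem_range.1 hk)
  rw [Finset.prod_const, Finset.card_range] at hprod
  calc (1 : ℝ) = 2 ^ D * (1 / 2) ^ D := by rw [← mul_pow]; norm_num
    _ ≤ 2 ^ D * ∏ k ∈ Finset.range D, |t - ((k : ℝ) + 1)| := by gcongr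

/-- `|p_D(i + 1/2)| ≥ 1` at every half-integer. -/
theorem one_le_abs_eval_nodePoly_half (i : ℕ) : 1 ≤ |(nodePoly D).eval ((i : ℝ) + 1 / 2)| := by
  refine one_le_abs_eval_nodePoly D _ fun k _ => ?_
  rcases Nat.lt_or_ge i (k + 1) with hk | hk
  · have hk' : (i : ℝ) ≤ k := by exact_mod_cast Nat.lt_succ_iff.mp hk
    rw [abs_of_neg (by linarith)]
    linarith
  · have hk' : (k : ℝ) + 1 ≤ i := by exact_mod_cast hk
    rw [abs_of_nonneg (by linarith)]
    linarith

/-- `|p_D(0)| ≥ 1`, i.e. the constant coefficient is at least `1` in absolute value. -/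
theorem one_le_abs_coeff_zero_nodePoly : 1 ≤ |(nodePoly D).coeff 0| := by
  rw [coeff_zero_eq_eval_zero]
  refine one_le_abs_eval_nodePoly D 0 fun k _ => ?_
  rw [zero_sub, abs_neg, abs_of_pos (by positivity)]
  have : (0 : ℝ) ≤ k := Nat.cast_nonneg k
  linarith

/-- `p_D(t)` as the coefficient sum over `Fin (D+1)`. -/
theorem sum_coeff_nodePoly (t : ℝ) :
    ∑ l : Fin (D + 1), t ^ (l : ℕ) * (nodePoly D).coeff l = (nodePoly D).eval t := by
  rw [eval_eq_sum_range' (natDegree_nodePoly_lt D), ← Fin.sum_univ_eq_sum_range]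
  exact Finset.sum_congr rfl fun l _ => mul_comm _ _

/-! ### Invertibility of the coefficients -/

/-- Every coefficient has negative determinant (`c_l² − a_l² − δ² < 0`). -/
theorem det_spS_neg (l : Fin (D + 1)) : (spS D l).det < 0 := by
  rw [spS, Matrix.det_fin_two_of]
  have hδ := driftδ_pos D
  by_cases hl : l = 0
  · subst hl
    simp only [if_true, Fin.val_zero]
    have h1 := one_le_abs_coeff_zero_nodePoly D
    have h2 : 1 ≤ ((nodePoly D).coeff 0) ^ 2 := by
      calc (1 : ℝ) ≤ |(nodePoly D).coeff 0| ^ 2 := by nlinarith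
        _ = ((nodePoly D).coeff 0) ^ 2 := sq_abs _
    nlinarith
  · simp only [hl, if_false]
    nlinarith [sq_nonneg ((nodePoly D).coeff l)]

/-- Every coefficient `S l` is invertible. -/
theorem spS_det_ne_zero (l : Fin (D + 1)) : (spS D l).det ≠ 0 := (det_spS_neg D l).ne

/-! ### Evaluating the pencil and its derived pencil -/

/-- The drift value `Y_D(t) = δ_D Σ_{l ≤ D} t^l`. -/
noncomputable def driftVal (t : ℝ) : ℝ := ∑ l : Fin (D + 1), t ^ (l : ℕ) * driftδ D

/-- The evaluated pencil is `[[1/2 + p_D(t), Y_D(t)], [Y_D(t), 1/2 − p_D(t)]]`. -/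
theorem pencil_eval_eq (t : ℝ) :
    ∑ l, t ^ spD D l • spS D l =
      !![1 / 2 + (nodePoly D).eval t, driftVal D t; driftVal D t, 1 / 2 - (nodePoly D).eval t] := by
  rw [← sum_coeff_nodePoly]
  ext i j
  fin_cases i <;> fin_cases j <;>
    simp [spS, spD, driftVal, Matrix.sum_apply, Finset.sum_add_distrib, Finset.sum_sub_distrib,
      mul_add, mul_sub]

/-- `det F_D(t) = 1/4 − p_D(t)² − Y_D(t)²`. -/
theorem eval_det_spF (t : ℝ) :
    ((∑ l, (X : ℝ[X]) ^ spD D l • (spS D l).map Polynomial.C).det).eval t =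
      1 / 4 - ((nodePoly D).eval t) ^ 2 - (driftVal D t) ^ 2 := by
  rw [eval_det_pencil, pencil_eval_eq, Matrix.det_fin_two_of]
  ring

/-- The derived pencil, evaluated at `t`, is `[[u, v], [v, −u]]` with
`v = δ_D Σ_{l<D} (l+1) t^l`. -/
theorem derived_eval_eq (t : ℝ) :
    ∑ l : Fin D, t ^ (spD D l.succ - spD D 0 - 1) • (((spD D l.succ - spD D 0 : ℕ) : ℝ) • spS D l.succ) =
      !![∑ l : Fin D, t ^ (l : ℕ) * (((l : ℕ) + 1 : ℝ) * (nodePoly D).coeff (l.succ)),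
          ∑ l : Fin D, t ^ (l : ℕ) * (((l : ℕ) + 1 : ℝ) * driftδ D);
         ∑ l : Fin D, t ^ (l : ℕ) * (((l : ℕ) + 1 : ℝ) * driftδ D),
          -∑ l : Fin D, t ^ (l : ℕ) * (((l : ℕ) + 1 : ℝ) * (nodePoly D).coeff (l.succ))] := by
  ext i j
  fin_cases i <;> fin_cases j <;>
    simp [spS, spD, Matrix.sum_apply, Fin.succ_ne_zero, Finset.sum_neg_distrib, mul_neg]

/-- The off-diagonal entry `v = δ_D Σ_{l<D} (l+1) t^l` of the derived pencil is positive on `(0,∞)`. -/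
theorem driftDeriv_pos (hD : 1 ≤ D) (t : ℝ) (ht : 0 < t) :
    0 < ∑ l : Fin D, t ^ (l : ℕ) * (((l : ℕ) + 1 : ℝ) * driftδ D) := by
  haveI : Nonempty (Fin D) := Fin.pos_iff_nonempty.1 hD
  have hδ := driftδ_pos D
  exact Finset.sum_pos (fun l _ => by positivity) Finset.univ_nonempty

/-- `det ∂F_D(t) = −u² − v² < 0` for `t > 0`: the derived pencil is everywhere indefinite. -/
theorem eval_det_derived_spF_neg (hD : 1 ≤ D) (t : ℝ) (ht : 0 < t) :
    ((∑ l : Fin D, (X : ℝ[X]) ^ (spD D l.succ - spD D 0 - 1) •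
        (((spD D l.succ - spD D 0 : ℕ) : ℝ) • spS D l.succ).map Polynomial.C).det).eval t < 0 := by
  rw [eval_det_pencil, derived_eval_eq, Matrix.det_fin_two_of]
  have hv := driftDeriv_pos D hD t ht
  nlinarith [sq_nonneg (∑ l : Fin D, t ^ (l : ℕ) * (((l : ℕ) + 1 : ℝ) * (nodePoly D).coeff (l.succ)))]

/-- **The Rolle term is dead:** the derived pencil of `F_D` has no positive root. -/
theorem card_posRoots_derived_spF (hD : 1 ≤ D) :
    ((∑ l : Fin D, (X : ℝ[X]) ^ (spD D l.succ - spD D 0 - 1) •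
        (((spD D l.succ - spD D 0 : ℕ) : ℝ) • spS D l.succ).map Polynomial.C).det.roots.toFinset.filter
      (fun t => 0 < t)).card = 0 := by
  rw [Finset.card_eq_zero, Finset.filter_eq_empty_iff]
  intro t ht hpos
  rw [Multiset.mem_toFinset] at ht
  have h := (mem_roots'.1 ht).2
  rw [IsRoot.def] at h
  exact (eval_det_derived_spF_neg D hD t hpos).ne h

/-! ### Signs of `det F_D` at the integers and the half-integers -/

/-- `Y_D(t) ≥ 0` for `t ≥ 0`. -/
theorem driftVal_nonneg (t : ℝ) (ht : 0 ≤ t) : 0 ≤ driftVal D t := by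
  unfold driftVal
  have hδ := driftδ_pos D
  exact Finset.sum_nonneg fun l _ => by positivity

/-- `Y_D(t) ≤ 1/4` on `[0, D]` (the choice of `δ_D`). -/
theorem driftVal_le (t : ℝ) (ht : 0 ≤ t) (htD : t ≤ D) : driftVal D t ≤ 1 / 4 := by
  unfold driftVal
  have hδ := driftδ_pos D
  have hD1 : (1 : ℝ) ≤ (D : ℝ) + 1 := by
    have : (0 : ℝ) ≤ D := Nat.cast_nonneg D
    linarith
  have hterm : ∀ l : Fin (D + 1), t ^ (l : ℕ) * driftδ D ≤ ((D : ℝ) + 1) ^ D * driftδ D := by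
    intro l
    refine mul_le_mul_of_nonneg_right ?_ hδ.le
    calc t ^ (l : ℕ) ≤ ((D : ℝ) + 1) ^ (l : ℕ) := pow_le_pow_left₀ ht (by linarith) _
      _ ≤ ((D : ℝ) + 1) ^ D := pow_le_pow_right₀ hD1 (Nat.lt_succ_iff.mp l.2)
  calc ∑ l : Fin (D + 1), t ^ (l : ℕ) * driftδ D
      ≤ ∑ _l : Fin (D + 1), ((D : ℝ) + 1) ^ D * driftδ D := Finset.sum_le_sum fun l _ => hterm l
    _ = ((D : ℝ) + 1) ^ (D + 1) * driftδ D := by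
        rw [Finset.sum_const, Finset.card_univ, Fintype.card_fin, nsmul_eq_mul, pow_succ]
        push_cast
        ring
    _ = 1 / 4 := by
        unfold driftδ
        have : (0 : ℝ) < ((D : ℝ) + 1) ^ (D + 1) := by positivity
        field_simp

/-- `det F_D(i) > 0` at the nodes `i = 1, …, D`. -/
theorem eval_det_spF_nat_pos (i : ℕ) (h1 : 1 ≤ i) (hi : i ≤ D) :
    0 < ((∑ l, (X : ℝ[X]) ^ spD D l • (spS D l).map Polynomial.C).det).eval (i : ℝ) := by
  rw [eval_det_spF, eval_nodePoly_nat D i h1 hi]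
  have h0 := driftVal_nonneg D (i : ℝ) (Nat.cast_nonneg i)
  have h4 := driftVal_le D (i : ℝ) (Nat.cast_nonneg i) (by exact_mod_cast hi)
  nlinarith

/-- `det F_D(i + 1/2) < 0` at every half-integer. -/
theorem eval_det_spF_half_neg (i : ℕ) :
    ((∑ l, (X : ℝ[X]) ^ spD D l • (spS D l).map Polynomial.C).det).eval ((i : ℝ) + 1 / 2) < 0 := by
  rw [eval_det_spF]
  have h1 := one_le_abs_eval_nodePoly_half D i
  have h2 : 1 ≤ ((nodePoly D).eval ((i : ℝ) + 1 / 2)) ^ 2 := by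
    calc (1 : ℝ) ≤ |(nodePoly D).eval ((i : ℝ) + 1 / 2)| ^ 2 := by nlinarith
      _ = _ := sq_abs _
  nlinarith [sq_nonneg (driftVal D ((i : ℝ) + 1 / 2))]

/-! ### `2D` alternations, hence `2D` positive roots -/

/-- The test points `1/2, 1, 3/2, …, D + 1/2`. -/
noncomputable def spτ (j : Fin (2 * D + 1)) : ℝ := ((j : ℕ) + 1) / 2

/-- The test points increase. -/
theorem spτ_strictMono : StrictMono (spτ D) := by
  intro a b h
  unfold spτ
  have : (a : ℝ) < b := by exact_mod_cast h
  linarith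

/-- The test points are positive. -/
theorem spτ_pos (j : Fin (2 * D + 1)) : 0 < spτ D j := by
  unfold spτ
  positivity

/-- `det F_D` alternates strictly in sign along the test points. -/
theorem spF_alt (j : Fin (2 * D)) :
    ((∑ l, (X : ℝ[X]) ^ spD D l • (spS D l).map Polynomial.C).det).eval (spτ D j.castSucc) *
      ((∑ l, (X : ℝ[X]) ^ spD D l • (spS D l).map Polynomial.C).det).eval (spτ D j.succ) < 0 := by
  obtain ⟨i, hi | hi⟩ := Nat.even_or_odd' (j : ℕ)
  · -- `j = 2i`: points `i + 1/2` (negative) and `i + 1` (positive)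
    have hiD : i + 1 ≤ D := by have := j.2; omega
    have e1 : spτ D j.castSucc = (i : ℝ) + 1 / 2 := by
      simp only [spτ, Fin.val_castSucc, hi]; push_cast; ring
    have e2 : spτ D j.succ = ((i + 1 : ℕ) : ℝ) := by
      simp only [spτ, Fin.val_succ, hi]; push_cast; ring
    rw [e1, e2]
    exact mul_neg_of_neg_of_pos (eval_det_spF_half_neg D i)
      (eval_det_spF_nat_pos D (i + 1) (by omega) hiD)
  · -- `j = 2i+1`: points `i + 1` (positive) and `(i+1) + 1/2` (negative)
    have hiD : i + 1 ≤ D := by have := j.2; omega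
    have e1 : spτ D j.castSucc = ((i + 1 : ℕ) : ℝ) := by
      simp only [spτ, Fin.val_castSucc, hi]; push_cast; ring
    have e2 : spτ D j.succ = ((i + 1 : ℕ) : ℝ) + 1 / 2 := by
      simp only [spτ, Fin.val_succ, hi]; push_cast; ring
    rw [e1, e2]
    exact mul_neg_of_pos_of_neg (eval_det_spF_nat_pos D (i + 1) (by omega) hiD)
      (eval_det_spF_half_neg D (i + 1))

/-- **Many roots:** `det F_D` has at least `2D` distinct positive roots. -/
theorem twoMul_le_card_posRoots_spF :
    2 * D ≤ ((∑ l, (X : ℝ[X]) ^ spD D l • (spS D l).map Polynomial.C).det.roots.toFinset.filter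
      (fun t => 0 < t)).card :=
  le_card_posRoots_of_alternating _ (2 * D) (spτ D) (spτ_strictMono D) (spτ_pos D) (spF_alt D)

end Family

end Summit.ValiantsHypothesis.ValiantsHypothesis.Theorems.DerivedPencilRolleQuasi.Negative
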